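import Mathlib
import HarnessLib
import Literature.Geometry.Riemannian.TwoConvexSchoenfliesProofs
import Summits.ValiantsHypothesis.ValiantsHypothesis.Theorems.KPlusLogSqLawWeakLiftingTowerGraftWronskianKFourConsecutiveScaled

/-!
# Tower graft line — CONJECTURE W AT `K = 4` PROVED ON THE SUPPORTS `(c, c+3h, c+4h, c+5h)` (sextic Vieta) AND THEIR MIRRORS

Helper file for LINE (B) `Cruxes/WeakLifting/Lines/tower_graft.lean` (crux `WeakLifting` = stmt-ValiantsHypothesis-19561), target (W-4) =
`ConjectureWAt 4` («`Z₊(W(u,v)) ≤ 4` for two real `4`-nomials on a common support»).  NO stub is claimed; `ConjectureWAt 4` stays OPEN.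
On `d = (c, c+3, c+4, c+5)` (member `n = 3` of the near-tight corner family `(0, n, n+1, n+2)` of the alternant law) the pair sums are
`2c+3, 2c+4, 2c+5, 2c+7, 2c+8, 2c+9`: `X·W(u,v) = X^{2c+3}·Q`, `Q` a SEXTIC WITHOUT CUBIC TERM with coefficients
`(3p₀₁, 4p₀₂, 5p₀₃, 0, p₁₂, 2p₁₃, p₂₃)`.  Five distinct positive zeros of `W` are roots of `Q`; if `p₂₃ = 0` a vanishing coefficient gives
`Z₊ ≤ 4` (`…KFourAlternating`); else `Q = (∏(X − rᵢ))·(aX + b)` has a sixth real root `ρ`, Vieta gives `ρ·e₂ = −e₃` (no cubic term) and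
turns the Plücker relation `40·a₀a₆ − 15·a₁a₅ + 24·a₂a₄ = 0` into `Ψ = 0`,
`Ψ := 24e₂³e₄ − 15e₁e₂²e₅ − 25e₂e₃e₅ − 9e₁e₂e₃e₄ − 24e₂²e₃² + 24e₁e₃³ − 15e₃²e₄` (e's of the five positive roots) — impossible:
`−Ψ = P + 12e₂²(e₃² − 2e₂e₄) + 12e₃²(e₂² − 2e₁e₃)` with `P > 0` and the two `n = 5` Newton inequalities (SOS over matchings).
* `esymm_five_*`; `newton_two_five`, `newton_three_five` (SOS identities); ★ `sextic_key_pos` (`−Ψ > 0`);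
* ★★ `card_posRoots_wronskian_four_le_four_sextic` — `Z₊(W(u,v)) ≤ 4` on `(c, c+3, c+4, c+5)` for all real `u, v`;
* ★★ `…_sextic_scaled` / `…_sextic_mirror` — the same on `(c, c+3h, c+4h, c+5h)` and on `(c, c+h, c+2h, c+5h)`, `h ≥ 1`.
HONEST FRAMING: support families only; nothing on S4/S4f/S5/S5ᴸ, TowerB, `WeakLifting`, Conjecture B, `MatrixDescartes` (18050), `VP ≠ VNP`.
Def-free.  Seat: prover leafhand-val-kpluslogsqlaw-1 g12, `--supports stmt-ValiantsHypothesis-19561 --as helper`.  [folklore: Vieta, Newton;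
the family theorem is this work]
-/

-- `Summit.ValiantsHypothesis.ValiantsHypothesis.…` repeats a component by the D-0017 layout
-- (single-conjunct summit), which the `dupNamespace` linter flags; the name is mandated.
set_option linter.dupNamespace false
set_option autoImplicit false

namespace Summit.ValiantsHypothesis.ValiantsHypothesis.Theorems.KPlusLogSqLaw.TowerGraft

open Polynomial Finset
open scoped BigOperators Polynomial
open Literature.Geometry.Riemannian (esymm_zero_eq_one esymm_cons_succ esymm_card_eq_prod esymm_nonneg_of_forall_nonneg
  esymm_eq_zero_of_card_lt)

namespace WronskianDevelopable

/-! ## §1 Elementary symmetric functions of an explicit five-element multiset -/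

/-- `e₁` of five elements. [folklore] -/
theorem esymm_five_one (a b c d e : ℝ) :
    (a ::ₘ b ::ₘ c ::ₘ d ::ₘ e ::ₘ 0).esymm 1 = a + b + c + d + e := by
  simp only [esymm_cons_succ, esymm_zero_eq_one, esymm_eq_zero_of_card_lt 0 (by simp : Multiset.card (0 : Multiset ℝ) < 1)]
  ring

/-- `e₂` of five elements. [folklore] -/
theorem esymm_five_two (a b c d e : ℝ) :
    (a ::ₘ b ::ₘ c ::ₘ d ::ₘ e ::ₘ 0).esymm 2 =
      a * b + a * c + a * d + a * e + b * c + b * d + b * e + c * d + c * e + d * e := by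
  simp only [esymm_cons_succ, esymm_zero_eq_one, esymm_eq_zero_of_card_lt 0 (by simp : Multiset.card (0 : Multiset ℝ) < 1),
    esymm_eq_zero_of_card_lt 0 (by simp : Multiset.card (0 : Multiset ℝ) < 2)]
  ring

/-- `e₃` of five elements. [folklore] -/
theorem esymm_five_three (a b c d e : ℝ) :
    (a ::ₘ b ::ₘ c ::ₘ d ::ₘ e ::ₘ 0).esymm 3 =
      a * b * c + a * b * d + a * b * e + a * c * d + a * c * e + a * d * e + b * c * d + b * c * e + b * d * e + c * d * e := by
  simp only [esymm_cons_succ, esymm_zero_eq_one, esymm_eq_zero_of_card_lt 0 (by simp : Multiset.card (0 : Multiset ℝ) < 1),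
    esymm_eq_zero_of_card_lt 0 (by simp : Multiset.card (0 : Multiset ℝ) < 2),
    esymm_eq_zero_of_card_lt 0 (by simp : Multiset.card (0 : Multiset ℝ) < 3)]
  ring

/-- `e₄` of five elements. [folklore] -/
theorem esymm_five_four (a b c d e : ℝ) :
    (a ::ₘ b ::ₘ c ::ₘ d ::ₘ e ::ₘ 0).esymm 4 =
      a * b * c * d + a * b * c * e + a * b * d * e + a * c * d * e + b * c * d * e := by
  simp only [esymm_cons_succ, esymm_zero_eq_one, esymm_eq_zero_of_card_lt 0 (by simp : Multiset.card (0 : Multiset ℝ) < 1),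
    esymm_eq_zero_of_card_lt 0 (by simp : Multiset.card (0 : Multiset ℝ) < 2),
    esymm_eq_zero_of_card_lt 0 (by simp : Multiset.card (0 : Multiset ℝ) < 3),
    esymm_eq_zero_of_card_lt 0 (by simp : Multiset.card (0 : Multiset ℝ) < 4)]
  ring

/-- `e₅` of five elements. [folklore] -/
theorem esymm_five_five (a b c d e : ℝ) :
    (a ::ₘ b ::ₘ c ::ₘ d ::ₘ e ::ₘ 0).esymm 5 = a * b * c * d * e := by
  have : Multiset.card (a ::ₘ b ::ₘ c ::ₘ d ::ₘ e ::ₘ 0) = 5 := by simp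
  rw [← this, esymm_card_eq_prod]
  simp [mul_assoc]

/-- `e₆` of five elements vanishes. [folklore] -/
theorem esymm_five_six (a b c d e : ℝ) : (a ::ₘ b ::ₘ c ::ₘ d ::ₘ e ::ₘ 0).esymm 6 = 0 :=
  esymm_eq_zero_of_card_lt _ (by simp)

/-! ## §2 Newton's inequalities `e₂² ≥ 2e₁e₃`, `e₃² ≥ 2e₂e₄` for five reals, and the key positivity -/

/-- `e₂² − 2e₁e₃ = ⅓·Σ (r_ar_b − r_cr_d)²` over the 15 matchings (five reals). [folklore: Newton, SOS form] -/
theorem newton_two_five (r : Fin 5 → ℝ) :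
    (r 0 * r 1 + r 0 * r 2 + r 0 * r 3 + r 0 * r 4 + r 1 * r 2 + r 1 * r 3 + r 1 * r 4 + r 2 * r 3 + r 2 * r 4 + r 3 * r 4) ^ 2 -
        2 * (r 0 + r 1 + r 2 + r 3 + r 4) * (r 0 * r 1 * r 2 + r 0 * r 1 * r 3 + r 0 * r 1 * r 4 + r 0 * r 2 * r 3 + r 0 * r 2 * r 4 + r 0 * r 3 * r 4 +
      r 1 * r 2 * r 3 + r 1 * r 2 * r 4 + r 1 * r 3 * r 4 + r 2 * r 3 * r 4) =
      (1 / 3 : ℝ) * ((r 0 * r 1 - r 2 * r 3) ^ 2 +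
        (r 0 * r 2 - r 1 * r 3) ^ 2 +
        (r 0 * r 3 - r 1 * r 2) ^ 2 +
        (r 0 * r 1 - r 2 * r 4) ^ 2 +
        (r 0 * r 2 - r 1 * r 4) ^ 2 +
        (r 0 * r 4 - r 1 * r 2) ^ 2 +
        (r 0 * r 1 - r 3 * r 4) ^ 2 +
        (r 0 * r 3 - r 1 * r 4) ^ 2 +
        (r 0 * r 4 - r 1 * r 3) ^ 2 +
        (r 0 * r 2 - r 3 * r 4) ^ 2 +
        (r 0 * r 3 - r 2 * r 4) ^ 2 +
        (r 0 * r 4 - r 2 * r 3) ^ 2 +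
        (r 1 * r 2 - r 3 * r 4) ^ 2 +
        (r 1 * r 3 - r 2 * r 4) ^ 2 +
        (r 1 * r 4 - r 2 * r 3) ^ 2) := by
  ring

/-- `e₃² − 2e₂e₄ = ⅓·Σ r_a²(r_br_c − r_dr_e)²` over the 15 pointed matchings (five reals). [folklore: Newton, SOS form] -/
theorem newton_three_five (r : Fin 5 → ℝ) :
    (r 0 * r 1 * r 2 + r 0 * r 1 * r 3 + r 0 * r 1 * r 4 + r 0 * r 2 * r 3 + r 0 * r 2 * r 4 + r 0 * r 3 * r 4 +
      r 1 * r 2 * r 3 + r 1 * r 2 * r 4 + r 1 * r 3 * r 4 + r 2 * r 3 * r 4) ^ 2 -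
        2 * (r 0 * r 1 + r 0 * r 2 + r 0 * r 3 + r 0 * r 4 + r 1 * r 2 + r 1 * r 3 + r 1 * r 4 + r 2 * r 3 + r 2 * r 4 + r 3 * r 4) * (r 0 * r 1 * r 2 * r 3 + r 0 * r 1 * r 2 * r 4 + r 0 * r 1 * r 3 * r 4 + r 0 * r 2 * r 3 * r 4 + r 1 * r 2 * r 3 * r 4) =
      (1 / 3 : ℝ) * (r 0 ^ 2 * (r 1 * r 2 - r 3 * r 4) ^ 2 +
        r 0 ^ 2 * (r 1 * r 3 - r 2 * r 4) ^ 2 +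
        r 0 ^ 2 * (r 1 * r 4 - r 2 * r 3) ^ 2 +
        r 1 ^ 2 * (r 0 * r 2 - r 3 * r 4) ^ 2 +
        r 1 ^ 2 * (r 0 * r 3 - r 2 * r 4) ^ 2 +
        r 1 ^ 2 * (r 0 * r 4 - r 2 * r 3) ^ 2 +
        r 2 ^ 2 * (r 0 * r 1 - r 3 * r 4) ^ 2 +
        r 2 ^ 2 * (r 0 * r 3 - r 1 * r 4) ^ 2 +
        r 2 ^ 2 * (r 0 * r 4 - r 1 * r 3) ^ 2 +
        r 3 ^ 2 * (r 0 * r 1 - r 2 * r 4) ^ 2 +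
        r 3 ^ 2 * (r 0 * r 2 - r 1 * r 4) ^ 2 +
        r 3 ^ 2 * (r 0 * r 4 - r 1 * r 2) ^ 2 +
        r 4 ^ 2 * (r 0 * r 1 - r 2 * r 3) ^ 2 +
        r 4 ^ 2 * (r 0 * r 2 - r 1 * r 3) ^ 2 +
        r 4 ^ 2 * (r 0 * r 3 - r 1 * r 2) ^ 2) := by
  ring

/-- ★ **the key positivity**: for five positive reals, `−Ψ = 15e₁e₂²e₅ + 25e₂e₃e₅ + 9e₁e₂e₃e₄ + 15e₃²e₄ + 24e₂²e₃² − 24e₂³e₄ − 24e₁e₃³ > 0`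
(`= P + 12e₂²(e₃² − 2e₂e₄) + 12e₃²(e₂² − 2e₁e₃)` with `P > 0`). [this work] -/
theorem sextic_key_pos (r : Fin 5 → ℝ) (hr0 : ∀ m, 0 < r m) (e1 e2 e3 e4 e5 : ℝ)
    (he1 : e1 = (r 0 + r 1 + r 2 + r 3 + r 4))
    (he2 : e2 = (r 0 * r 1 + r 0 * r 2 + r 0 * r 3 + r 0 * r 4 + r 1 * r 2 + r 1 * r 3 + r 1 * r 4 + r 2 * r 3 + r 2 * r 4 + r 3 * r 4))
    (he3 : e3 = (r 0 * r 1 * r 2 + r 0 * r 1 * r 3 + r 0 * r 1 * r 4 + r 0 * r 2 * r 3 + r 0 * r 2 * r 4 + r 0 * r 3 * r 4 +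
      r 1 * r 2 * r 3 + r 1 * r 2 * r 4 + r 1 * r 3 * r 4 + r 2 * r 3 * r 4))
    (he4 : e4 = (r 0 * r 1 * r 2 * r 3 + r 0 * r 1 * r 2 * r 4 + r 0 * r 1 * r 3 * r 4 + r 0 * r 2 * r 3 * r 4 + r 1 * r 2 * r 3 * r 4))
    (he5 : e5 = (r 0 * r 1 * r 2 * r 3 * r 4)) :
    0 < -((24 * e2 * e4 - 15 * e1 * e5) * e2 ^ 2 - (25 * e5 + 9 * e1 * e4 + 24 * e2 * e3) * e2 * e3 +
      (24 * e1 * e3 - 15 * e4) * e3 ^ 2) := by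
  have h0 := hr0 0; have h1 := hr0 1; have h2 := hr0 2; have h3 := hr0 3; have h4 := hr0 4
  have N2 : 0 ≤ e2 ^ 2 - 2 * e1 * e3 := by
    rw [he1, he2, he3, newton_two_five r]; positivity
  have N1 : 0 ≤ e3 ^ 2 - 2 * e2 * e4 := by
    rw [he2, he3, he4, newton_three_five r]; positivity
  have he1p : 0 < e1 := by rw [he1]; positivity
  have he2p : 0 < e2 := by rw [he2]; positivity
  have he3p : 0 < e3 := by rw [he3]; positivity
  have he4p : 0 < e4 := by rw [he4]; positivity
  have he5p : 0 < e5 := by rw [he5]; positivity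
  have hid : -((24 * e2 * e4 - 15 * e1 * e5) * e2 ^ 2 - (25 * e5 + 9 * e1 * e4 + 24 * e2 * e3) * e2 * e3 +
      (24 * e1 * e3 - 15 * e4) * e3 ^ 2) =
      (15 * e1 * e2 ^ 2 * e5 + 25 * e2 * e3 * e5 + 9 * e1 * e2 * e3 * e4 + 15 * e3 ^ 2 * e4) +
        12 * e2 ^ 2 * (e3 ^ 2 - 2 * e2 * e4) + 12 * e3 ^ 2 * (e2 ^ 2 - 2 * e1 * e3) := by
    ring
  rw [hid]
  have t1 : 0 ≤ 12 * e2 ^ 2 * (e3 ^ 2 - 2 * e2 * e4) := by positivity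
  have t2 : 0 ≤ 12 * e3 ^ 2 * (e2 ^ 2 - 2 * e1 * e3) := by positivity
  have t3 : 0 < 15 * e1 * e2 ^ 2 * e5 + 25 * e2 * e3 * e5 + 9 * e1 * e2 * e3 * e4 + 15 * e3 ^ 2 * e4 := by positivity
  linarith

/-! ## §3 The family `d = (c, c+3, c+4, c+5)` -/

/-- `X·W(u,v) = X^{2c+3}·Q` with `Q` the cubic-free sextic `3p₀₁ + 4p₀₂X + 5p₀₃X² + p₁₂X⁴ + 2p₁₃X⁵ + p₂₃X⁶`. [this work] -/
theorem X_mul_wronskian_sextic_eq (u v : Fin 4 → ℝ) (c : ℕ) :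
    (X : ℝ[X]) * wronskian (∑ l, C (u l) * (X : ℝ[X]) ^ (![c, c + 3, c + 4, c + 5] : Fin 4 → ℕ) l)
        (∑ l, C (v l) * (X : ℝ[X]) ^ (![c, c + 3, c + 4, c + 5] : Fin 4 → ℕ) l) =
      X ^ (2 * c + 3) *
        (C ((u 0 * v 1 - u 1 * v 0) * 3) + C ((u 0 * v 2 - u 2 * v 0) * 4) * X + C ((u 0 * v 3 - u 3 * v 0) * 5) * X ^ 2 +
          C (u 1 * v 2 - u 2 * v 1) * X ^ 4 + C ((u 1 * v 3 - u 3 * v 1) * 2) * X ^ 5 + C (u 2 * v 3 - u 3 * v 2) * X ^ 6) := by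
  rw [X_mul_wronskian_four_eq]
  simp only [Matrix.cons_val_zero, Matrix.cons_val_one, Matrix.cons_val]
  push_cast
  have e1 : (X : ℝ[X]) ^ (c + (c + 3)) = X ^ (2 * c + 3) := by ring_nf
  have e2 : (X : ℝ[X]) ^ (c + (c + 4)) = X ^ (2 * c + 3) * X := by ring_nf
  have e3 : (X : ℝ[X]) ^ (c + (c + 5)) = X ^ (2 * c + 3) * X ^ 2 := by ring_nf
  have e4 : (X : ℝ[X]) ^ (c + 3 + (c + 4)) = X ^ (2 * c + 3) * X ^ 4 := by ring_nf
  have e5 : (X : ℝ[X]) ^ (c + 3 + (c + 5)) = X ^ (2 * c + 3) * X ^ 5 := by ring_nf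
  have e6 : (X : ℝ[X]) ^ (c + 4 + (c + 5)) = X ^ (2 * c + 3) * X ^ 6 := by ring_nf
  rw [e1, e2, e3, e4, e5, e6]
  have n1 : ((c : ℝ) + 3 - c) = 3 := by ring
  have n2 : ((c : ℝ) + 4 - c) = 4 := by ring
  have n3 : ((c : ℝ) + 5 - c) = 5 := by ring
  have n4 : ((c : ℝ) + 4 - (c + 3)) = 1 := by ring
  have n5 : ((c : ℝ) + 5 - (c + 3)) = 2 := by ring
  have n6 : ((c : ℝ) + 5 - (c + 4)) = 1 := by ring
  rw [n1, n2, n3, n4, n5, n6, mul_one, mul_one]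
  ring

/-- ★★ **CONJECTURE W AT `K = 4` ON THE SUPPORTS `(c, c+3, c+4, c+5)`**: `Z₊(W(u,v)) ≤ 4` for all real `u, v`. [this work] -/
theorem card_posRoots_wronskian_four_le_four_sextic (u v : Fin 4 → ℝ) (c : ℕ) :
    ((wronskian (∑ l, C (u l) * (X : ℝ[X]) ^ (![c, c + 3, c + 4, c + 5] : Fin 4 → ℕ) l)
        (∑ l, C (v l) * (X : ℝ[X]) ^ (![c, c + 3, c + 4, c + 5] : Fin 4 → ℕ) l)).roots.toFinset.filter
      (fun x => 0 < x)).card ≤ 4 := by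
  classical
  have hdm : StrictMono (![c, c + 3, c + 4, c + 5] : Fin 4 → ℕ) := by
    refine Fin.strictMono_iff_lt_succ.mpr fun i => ?_
    fin_cases i <;> simp
  have hA : (![c, c + 3, c + 4, c + 5] : Fin 4 → ℕ) 0 + (![c, c + 3, c + 4, c + 5] : Fin 4 → ℕ) 3 <
      (![c, c + 3, c + 4, c + 5] : Fin 4 → ℕ) 1 + (![c, c + 3, c + 4, c + 5] : Fin 4 → ℕ) 2 := by
    simp; omega
  set W : ℝ[X] := wronskian (∑ l, C (u l) * (X : ℝ[X]) ^ (![c, c + 3, c + 4, c + 5] : Fin 4 → ℕ) l)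
        (∑ l, C (v l) * (X : ℝ[X]) ^ (![c, c + 3, c + 4, c + 5] : Fin 4 → ℕ) l) with hW
  have hXW := X_mul_wronskian_sextic_eq u v c
  rw [← hW] at hXW
  by_contra hgt
  have h5 : 5 ≤ (W.roots.toFinset.filter (fun x => 0 < x)).card := by omega
  -- a vanishing top Plücker coordinate gives `≤ 4` outright
  by_cases hp23z : u 2 * v 3 - u 3 * v 2 = 0
  · have h4 := card_posRoots_wronskian_four_le_four_of_consecutive_nonneg u v _ hdm hA 4 (by norm_num) (by
      simp [hp23z])
    exact hgt h4
  -- Plücker coordinates (with the exponent-difference weights) and the sextic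
  set q0 := (u 0 * v 1 - u 1 * v 0) * 3 with hq0
  set q1 := (u 0 * v 2 - u 2 * v 0) * 4 with hq1
  set q2 := (u 0 * v 3 - u 3 * v 0) * 5 with hq2
  set p12 := u 1 * v 2 - u 2 * v 1 with hp12
  set q5 := (u 1 * v 3 - u 3 * v 1) * 2 with hq5
  set p23 := u 2 * v 3 - u 3 * v 2 with hp23def
  set Q : ℝ[X] := C q0 + C q1 * X + C q2 * X ^ 2 + C p12 * X ^ 4 + C q5 * X ^ 5 + C p23 * X ^ 6 with hQ
  have hW0 : W ≠ 0 := by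
    intro h0; rw [h0, roots_zero] at h5; simp at h5
  have hQ0 : Q ≠ 0 := by
    intro h0
    rw [h0, mul_zero] at hXW
    exact hW0 ((mul_eq_zero.mp hXW).resolve_left X_ne_zero)
  have hdegQ : Q.natDegree = 6 := by
    refine natDegree_eq_of_le_of_coeff_ne_zero (by rw [hQ]; compute_degree!) ?_
    rw [hQ]; simpa using hp23z
  have hL : Q.leadingCoeff = p23 := by
    rw [Polynomial.leadingCoeff, hdegQ, hQ]; simp
  -- five distinct positive zeros of `W`, all roots of `Q`
  obtain ⟨T, hTS, hT⟩ := Finset.exists_subset_card_eq h5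
  have hTpos : ∀ x ∈ T, 0 < x := fun x hx => (Finset.mem_filter.mp (hTS hx)).2
  have hTQ : ∀ x ∈ T, Q.IsRoot x := by
    intro x hx
    have hxW : W.IsRoot x := by
      have h := (Finset.mem_filter.mp (hTS hx)).1
      rw [Multiset.mem_toFinset] at h
      exact (mem_roots hW0).mp h
    have h1 : ((X : ℝ[X]) * W).eval x = 0 := by rw [eval_mul, hxW.eq_zero, mul_zero]
    rw [hXW, eval_mul, eval_pow, eval_X] at h1
    rcases mul_eq_zero.mp h1 with h | h
    · exact absurd (pow_eq_zero_iff (by omega) |>.mp h) (hTpos x hx).ne'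
    · exact h
  have hTle : T.val ≤ Q.roots := by
    rw [Multiset.le_iff_subset T.nodup]
    intro x hx
    exact (mem_roots hQ0).mpr (hTQ x hx)
  -- factor `Q = (∏ (X − t)) · R` with `R` linear, sixth root `ρ`
  obtain ⟨R, hQR⟩ := (Multiset.prod_X_sub_C_dvd_iff_le_roots hQ0 T.val).mpr hTle
  set P5 : ℝ[X] := (T.val.map fun a => X - C a).prod with hP5
  have hP5deg : P5.natDegree = 5 := by
    rw [hP5, natDegree_multiset_prod_X_sub_C_eq_card, Finset.card_val, hT]
  have hP5ne : P5 ≠ 0 := (monic_multisetProd_X_sub_C T.val).ne_zero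
  have hRne : R ≠ 0 := by
    intro h0; rw [h0, mul_zero] at hQR; exact hQ0 hQR
  have hRdeg : R.natDegree = 1 := by
    have := natDegree_mul hP5ne hRne
    rw [← hQR, hdegQ, hP5deg] at this
    omega
  have hRform := eq_X_add_C_of_natDegree_le_one hRdeg.le
  set a := R.coeff 1 with ha
  set b := R.coeff 0 with hb
  have ha0 : a ≠ 0 := by
    have : R.leadingCoeff ≠ 0 := leadingCoeff_ne_zero.mpr hRne
    rw [Polynomial.leadingCoeff, hRdeg] at this
    exact this
  set ρ : ℝ := -(b / a) with hρ
  have hRfac : R = C a * (X - C ρ) := by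
    rw [hRform, hρ, map_neg, sub_neg_eq_add, mul_add, ← C_mul, mul_div_cancel₀ b ha0]
  have hroots : Q.roots = ρ ::ₘ T.val := by
    rw [hQR, mul_comm, roots_mul (by rw [mul_comm, ← hQR]; exact hQ0), hRfac, roots_C_mul _ ha0, roots_X_sub_C,
      roots_multiset_prod_X_sub_C, Multiset.singleton_add]
  have hrc : Multiset.card Q.roots = Q.natDegree := by
    rw [hroots, Multiset.card_cons, Finset.card_val, hT, hdegQ]
  set r : Fin 5 → ℝ := fun m => T.orderEmbOfFin hT m with hr_def
  have hr : StrictMono r := fun i j hij => (T.orderEmbOfFin hT).strictMono hij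
  have hrT : ∀ m, r m ∈ T := fun m => Finset.orderEmbOfFin_mem T hT m
  have hr0 : ∀ m, 0 < r m := fun m => hTpos _ (hrT m)
  have hs5 : T.val = r 0 ::ₘ r 1 ::ₘ r 2 ::ₘ r 3 ::ₘ r 4 ::ₘ 0 := by
    symm
    refine Multiset.eq_of_le_of_card_le ?_ ?_
    · rw [Multiset.le_iff_subset (by simp [Multiset.nodup_cons, hr.injective.eq_iff])]
      intro x hx
      simp only [Multiset.mem_cons, Multiset.notMem_zero, or_false] at hx
      rcases hx with h | h | h | h | h <;> (rw [h]; exact hrT _)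
    · simp [hT]
  have vieta : ∀ k, k ≤ 6 → Q.coeff k = p23 * (-1) ^ (6 - k) * (ρ ::ₘ (r 0 ::ₘ r 1 ::ₘ r 2 ::ₘ r 3 ::ₘ r 4 ::ₘ 0)).esymm (6 - k) := by
    intro k hk
    have := Polynomial.coeff_eq_esymm_roots_of_card hrc (k := k) (by rw [hdegQ]; exact hk)
    rw [hL, hdegQ, hroots, hs5] at this
    exact this
  -- the elementary symmetric functions of the five positive roots
  obtain ⟨e1, he1⟩ : ∃ e1 : ℝ, e1 = r 0 + r 1 + r 2 + r 3 + r 4 := ⟨_, rfl⟩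
  obtain ⟨e2, he2⟩ : ∃ e2 : ℝ, e2 = r 0 * r 1 + r 0 * r 2 + r 0 * r 3 + r 0 * r 4 + r 1 * r 2 + r 1 * r 3 + r 1 * r 4 +
    r 2 * r 3 + r 2 * r 4 + r 3 * r 4 := ⟨_, rfl⟩
  obtain ⟨e3, he3⟩ : ∃ e3 : ℝ, e3 = r 0 * r 1 * r 2 + r 0 * r 1 * r 3 + r 0 * r 1 * r 4 + r 0 * r 2 * r 3 + r 0 * r 2 * r 4 +
    r 0 * r 3 * r 4 + r 1 * r 2 * r 3 + r 1 * r 2 * r 4 + r 1 * r 3 * r 4 + r 2 * r 3 * r 4 := ⟨_, rfl⟩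
  obtain ⟨e4, he4⟩ : ∃ e4 : ℝ, e4 = r 0 * r 1 * r 2 * r 3 + r 0 * r 1 * r 2 * r 4 + r 0 * r 1 * r 3 * r 4 +
    r 0 * r 2 * r 3 * r 4 + r 1 * r 2 * r 3 * r 4 := ⟨_, rfl⟩
  obtain ⟨e5, he5⟩ : ∃ e5 : ℝ, e5 = r 0 * r 1 * r 2 * r 3 * r 4 := ⟨_, rfl⟩
  have E1 : (ρ ::ₘ (r 0 ::ₘ r 1 ::ₘ r 2 ::ₘ r 3 ::ₘ r 4 ::ₘ 0)).esymm 1 = e1 + ρ := by rw [esymm_cons_succ, esymm_five_one, esymm_zero_eq_one, he1]; ring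
  have E2 : (ρ ::ₘ (r 0 ::ₘ r 1 ::ₘ r 2 ::ₘ r 3 ::ₘ r 4 ::ₘ 0)).esymm 2 = e2 + ρ * e1 := by rw [esymm_cons_succ, esymm_five_two, esymm_five_one, he1, he2]
  have E3 : (ρ ::ₘ (r 0 ::ₘ r 1 ::ₘ r 2 ::ₘ r 3 ::ₘ r 4 ::ₘ 0)).esymm 3 = e3 + ρ * e2 := by rw [esymm_cons_succ, esymm_five_three, esymm_five_two, he2, he3]
  have E4 : (ρ ::ₘ (r 0 ::ₘ r 1 ::ₘ r 2 ::ₘ r 3 ::ₘ r 4 ::ₘ 0)).esymm 4 = e4 + ρ * e3 := by rw [esymm_cons_succ, esymm_five_four, esymm_five_three, he3, he4]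
  have E5 : (ρ ::ₘ (r 0 ::ₘ r 1 ::ₘ r 2 ::ₘ r 3 ::ₘ r 4 ::ₘ 0)).esymm 5 = e5 + ρ * e4 := by rw [esymm_cons_succ, esymm_five_five, esymm_five_four, he4, he5]
  have E6 : (ρ ::ₘ (r 0 ::ₘ r 1 ::ₘ r 2 ::ₘ r 3 ::ₘ r 4 ::ₘ 0)).esymm 6 = ρ * e5 := by
    rw [esymm_cons_succ, esymm_five_six, esymm_five_five, he5]; ring
  have hc0 : Q.coeff 0 = q0 := (by rw [hQ]; simp); have hc1 : Q.coeff 1 = q1 := (by rw [hQ]; simp)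
  have hc2 : Q.coeff 2 = q2 := (by rw [hQ]; simp); have hc3 : Q.coeff 3 = 0 := (by rw [hQ]; simp)
  have hc4 : Q.coeff 4 = p12 := (by rw [hQ]; simp); have hc5 : Q.coeff 5 = q5 := (by rw [hQ]; simp)
  have pw6 : ((-1 : ℝ)) ^ (6 - 0) = 1 := (by norm_num); have pw5 : ((-1 : ℝ)) ^ (6 - 1) = -1 := (by norm_num)
  have pw4 : ((-1 : ℝ)) ^ (6 - 2) = 1 := (by norm_num); have pw3 : ((-1 : ℝ)) ^ (6 - 3) = -1 := (by norm_num)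
  have pw2 : ((-1 : ℝ)) ^ (6 - 4) = 1 := (by norm_num); have pw1 : ((-1 : ℝ)) ^ (6 - 5) = -1 := (by norm_num)
  have a0 : q0 = p23 * (ρ * e5) := by
    have := vieta 0 (by norm_num); rw [hc0, pw6, E6] at this; linear_combination this
  have a1 : q1 = -(p23 * (e5 + ρ * e4)) := by
    have := vieta 1 (by norm_num); rw [hc1, pw5, E5] at this; linear_combination this
  have a2 : q2 = p23 * (e4 + ρ * e3) := by
    have := vieta 2 (by norm_num); rw [hc2, pw4, E4] at this; linear_combination this
  have a3 : p23 * (e3 + ρ * e2) = 0 := by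
    have := vieta 3 (by norm_num); rw [hc3, pw3, E3] at this; linear_combination this
  have a4 : p12 = p23 * (e2 + ρ * e1) := by
    have := vieta 4 (by norm_num); rw [hc4, pw2, E2] at this; linear_combination this
  have a5 : q5 = -(p23 * (e1 + ρ)) := by
    have := vieta 5 (by norm_num); rw [hc5, pw1, E1] at this; linear_combination this
  -- the Plücker relation `p₀₁p₂₃ − p₀₂p₁₃ + p₀₃p₁₂ = 0`, times `120`
  have plucker : 40 * q0 * p23 - 15 * q1 * q5 + 24 * q2 * p12 = 0 := by
    rw [hq0, hq1, hq2, hp12, hq5, hp23def]; ring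
  rw [a0, a1, a2, a4, a5] at plucker
  have hsq : 0 < p23 ^ 2 := by positivity
  -- `E₃ = 0` and the reduced Plücker relation
  have ht : ρ * e2 + e3 = 0 := by
    rcases mul_eq_zero.mp a3 with h | h
    · exact absurd h hp23z
    · linarith
  have hF : 40 * (ρ * e5) - 15 * (e1 + ρ) * (e5 + ρ * e4) + 24 * (e2 + ρ * e1) * (e4 + ρ * e3) = 0 := by
    have : p23 ^ 2 * (40 * (ρ * e5) - 15 * (e1 + ρ) * (e5 + ρ * e4) + 24 * (e2 + ρ * e1) * (e4 + ρ * e3)) = 0 := by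
      linear_combination plucker
    rcases mul_eq_zero.mp this with h | h
    · exact absurd h hsq.ne'
    · exact h
  -- eliminate `ρ`: `Ψ = 0`
  have hΨ : (24 * e2 * e4 - 15 * e1 * e5) * e2 ^ 2 - (25 * e5 + 9 * e1 * e4 + 24 * e2 * e3) * e2 * e3 +
      (24 * e1 * e3 - 15 * e4) * e3 ^ 2 = 0 := by
    linear_combination (e2 ^ 2) * hF -
      ((25 * e5 + 9 * e1 * e4 + 24 * e2 * e3) * e2 - 2 * (24 * e1 * e3 - 15 * e4) * e3 +
        (24 * e1 * e3 - 15 * e4) * (ρ * e2 + e3)) * ht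
  have hpos := sextic_key_pos r hr0 e1 e2 e3 e4 e5 he1 he2 he3 he4 he5
  linarith

/-! ## §4 Homothety and mirror -/

/-- ★★ **CONJECTURE W AT `K = 4` ON THE SUPPORTS `(c, c+3h, c+4h, c+5h)`** (`h ≥ 1`). [this work] -/
theorem card_posRoots_wronskian_four_le_four_sextic_scaled (u v : Fin 4 → ℝ) (c h : ℕ) (hh : 0 < h) :
    ((wronskian (∑ l, C (u l) * (X : ℝ[X]) ^ (![c, c + 3 * h, c + 4 * h, c + 5 * h] : Fin 4 → ℕ) l)
        (∑ l, C (v l) * (X : ℝ[X]) ^ (![c, c + 3 * h, c + 4 * h, c + 5 * h] : Fin 4 → ℕ) l)).roots.toFinset.filter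
      (fun x => 0 < x)).card ≤ 4 := by
  have hfun : (![c, c + 3 * h, c + 4 * h, c + 5 * h] : Fin 4 → ℕ) = fun l => c + h * (![0, 3, 4, 5] : Fin 4 → ℕ) l := by
    funext l; fin_cases l <;> simp <;> ring
  rw [hfun]
  refine (card_posRoots_wronskian_scaled_le u v _ c h hh).trans ?_
  have h0 : (![0, 3, 4, 5] : Fin 4 → ℕ) = ![0, 0 + 3, 0 + 4, 0 + 5] := by norm_num
  rw [h0]
  exact card_posRoots_wronskian_four_le_four_sextic u v 0

/-- ★★ **CONJECTURE W AT `K = 4` ON THE MIRROR SUPPORTS `(c, c+h, c+2h, c+5h)`** (`h ≥ 1`; orientation `d₁+d₂ < d₀+d₃`).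
[this work] -/
theorem card_posRoots_wronskian_four_le_four_sextic_mirror (u v : Fin 4 → ℝ) (c h : ℕ) (hh : 0 < h) :
    ((wronskian (∑ l, C (u l) * (X : ℝ[X]) ^ (![c, c + h, c + 2 * h, c + 5 * h] : Fin 4 → ℕ) l)
        (∑ l, C (v l) * (X : ℝ[X]) ^ (![c, c + h, c + 2 * h, c + 5 * h] : Fin 4 → ℕ) l)).roots.toFinset.filter
      (fun x => 0 < x)).card ≤ 4 := by
  set d : Fin 4 → ℕ := ![c, c + h, c + 2 * h, c + 5 * h] with hd
  have hD : ∀ l, d l ≤ c + 5 * h := by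
    intro l; fin_cases l <;> simp [hd] <;> omega
  refine (card_posRoots_wronskian_le_reflect u v d (c + 5 * h) hD).trans ?_
  have hexp : ∀ l : Fin 4, c + 5 * h - d (Fin.rev l) = 0 + h * (![0, 3, 4, 5] : Fin 4 → ℕ) l := by
    intro l
    fin_cases l
    · show c + 5 * h - d (Fin.rev 0) = 0 + h * 0
      rw [show Fin.rev (0 : Fin 4) = 3 by decide]; simp [hd]
    · show c + 5 * h - d (Fin.rev 1) = 0 + h * 3
      rw [show Fin.rev (1 : Fin 4) = 2 by decide]; simp [hd]; omega
    · show c + 5 * h - d (Fin.rev 2) = 0 + h * 4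
      rw [show Fin.rev (2 : Fin 4) = 1 by decide]; simp [hd]; omega
    · show c + 5 * h - d (Fin.rev 3) = 0 + h * 5
      rw [show Fin.rev (3 : Fin 4) = 0 by decide]; simp [hd]; omega
  simp_rw [hexp]
  refine (card_posRoots_wronskian_scaled_le (fun l => u (Fin.rev l)) (fun l => v (Fin.rev l)) _ 0 h hh).trans ?_
  have h0 : (![0, 3, 4, 5] : Fin 4 → ℕ) = ![0, 0 + 3, 0 + 4, 0 + 5] := by norm_num
  rw [h0]
  exact card_posRoots_wronskian_four_le_four_sextic _ _ 0

end WronskianDevelopable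

end Summit.ValiantsHypothesis.ValiantsHypothesis.Theorems.KPlusLogSqLaw.TowerGraft
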